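import Literature.NumberTheory.GaloisRepresentations.HeckeCharacterExtensionQuadraticCMProofs
import Mathlib.NumberTheory.NumberField.Units.DirichletTheorem
import HarnessLib

/-!
# Extension of unitary idele class characters along a quadratic extension with prescribed
# unramifiedness — the general case: discharge of `HewittRoss_heckeCharacter_extension_quadratic`
# (Weil's extension principle + Dirichlet's unit theorem; no Pontryagin duality)

Topic `NumberTheory/GaloisRepresentations`; namespaces `Literature.NumberTheory.GaloisRepresentations`,
`….HeckeCharacter`, `….HeckeCharacter.QuadraticExtension`.  Proof file (theorems only: no definition,
no named fact, no instance), fourth after `…WeilProofs`, `…ArchProofs`, `…CMProofs`, which proved the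
CM / finite-order special case of the named fact `HewittRoss_heckeCharacter_extension_quadratic`
(`HeckeCharacterExtensionQuadratic.lean`: for `K/F₀` quadratic with non-trivial automorphism `c`, a
unitary Hecke character `χ₀` of `F₀` and a set `U` of finite places of `K` with `χ₀` unramified below
`u` whenever `u, c • u ∈ U`, there is a unitary Hecke character `χ` of `K` with `χ ∘ BC = χ₀` on
`𝕀_{F₀}`, unramified on `U`).  Here the GENERAL case is proved —
`HewittRoss_heckeCharacter_extension_quadratic_holds` — still without the duality theorem for locally
compact abelian groups (absent from Mathlib), the one non-formal input of the derivation recorded in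
the statement file ("extend the character of the closed subgroup `H · C` by Hewitt–Ross (24.12)")
being replaced by Dirichlet's unit theorem, as follows.

* §1 `exists_archParams_prod_archUnitaryValue_unit_eq` — **Dirichlet freedom**: every unitary
  character of `𝓞_Kˣ` is `u ↦ ∏_w (σ_w u/|σ_w u|)^{n_w} |σ_w u|^{i t_w}` for some `n_w ∈ ℤ`, `t_w ∈ ℝ`
  (torsion: `σ(ζ)` is a primitive root of unity; free part: the logarithmic vectors of
  `NumberField.Units.fundSystem` are a `ℤ`-basis of the full lattice `unitLattice K`, hence an
  `ℝ`-basis (`Basis.ofZLatticeBasis`), so a linear functional takes prescribed values on them).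
* §2 bookkeeping for principal triples `a_K · y = (k)`, `y ∈ V = 𝕌_K ∩ W_𝔣`: `y / c • y = (k / c k)`,
  `k / c k ∈ 𝓞_Kˣ`, the infinite part of `c • y`, and the key identity for `k ∈ F₀`
  (`key_of_mem_range'`, the general-signature form of `CMQuadraticExtension.key_of_mem_range`).
* §3 `HeckeCharacter.exists_extension_quadratic_of_archChar` — **the engine**: from ANY unitary
  continuous character `Φ` of `(K ⊗ ℝ)ˣ` with `Φ ∘ BC_∞ = χ₀,∞` to the conclusion of the named fact.  On
  the admissible triples the value `χ₀(a) Φ(y_∞)` is `1` when `c k = k`, hence a unitary character `f̄`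
  of the norm-one units `k / c k`; replacing `Φ` by `Φ · (ψ ∘ (z ↦ z / c • z))` (which leaves
  `Φ ∘ BC_∞` unchanged, `c • x_K = x_K`) multiplies it by `ψ((k / c k)_∞)`, and §1 (after a Baer
  extension of `f̄⁻¹` to `Kˣ`, `Subgroup.exists_monoidHom_extension`) supplies a product-form `ψ`
  killing it; then Weil's extension principle `HeckeCharacter.exists_extension_of_key` (tree) gives
  `χ`, equal to `Φ' ∘ (·)_∞` on `V ∋` the local units at `u ∈ U`.
* §4 `QuadraticExtension.exists_archChar_baseChange_eq` — an archimedean character over `χ₀,∞` for an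
  ARBITRARY unitary `χ₀` and arbitrary signatures (no classification of the characters of `ℝˣ`, `ℂˣ`
  is needed): one place `w_v` of `K` above each `v`; over a real `v`,
  `z ↦ χ₀,v(|ι z_{w_v}|) (ι z_{w_v}/|ι z_{w_v}|)^{b_v}` with `χ₀,v(-1) = (-1)^{b_v}`; over a complex `v`,
  `z ↦ χ₀,v(ι_v⁻¹(τ ι z_{w_v}))`, `τ ∈ {1, conj}` (`extensionEmbedding_infiniteCompletionOfComap_or`).
* §5 the discharge `HewittRoss_heckeCharacter_extension_quadratic_holds` (and the binder form
  `HeckeCharacter.HewittRoss_heckeCharacter_extension_quadratic_holds'`).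

Consumers: `exists_heckeCharacter_restrict_eq_classFieldCharacter` (`AsaiSignArchParityTwist`: a
character `χ_- ∈ 𝒵_E^-` of Mok 2014 §2.1 for every quadratic `E/F`, whence the stratum "`N` odd,
`κ = -1`" of `Mok2014_archimedean_parity_of_asaiSign` from `Mok2014_standardBaseChange_descent` and
infinity types alone); the crux `QuadraticWindow.HostInducedRep` (`stub_factExt`).

## References

* A. Weil, *On a certain type of characters of the idèle-class group of an algebraic number-field*,
  Proc. Int. Symp. Tokyo–Nikko 1955 (1956), 1–7, §1. [Weil1956]
* E. Hewitt, K. A. Ross, *Abstract Harmonic Analysis* I, Grundlehren 115 (1979), Thm. (24.12). [HewittRoss1979]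
* J. Neukirch, *Algebraic Number Theory*, Grundlehren 322 (1999), Ch. I §7 (Dirichlet's unit theorem),
  Ch. VI §1, Ch. VII §6. [NeukirchANT1999]
-/

noncomputable section

open scoped NumberField Topology
open NumberField IsDedekindDomain Filter
open Literature.NumberTheory.Automorphic

namespace Literature.NumberTheory.GaloisRepresentations

/-! ### §1. Dirichlet freedom: every unitary character of `𝓞_Kˣ` is the restriction of a
product-form archimedean character `∏_w (ι_w ·/|ι_w ·|)^{n_w} |ι_w ·|^{i t_w}` -/

section DirichletFreedom

variable {K : Type*} [Field K] [NumberField K]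

open NumberField.Units NumberField.Units.dirichletUnitTheorem in
/-- **Dirichlet freedom for archimedean parameters.**  Every unitary character `g` of the unit
group `𝓞_Kˣ` is of the shape `u ↦ ∏_w (σ_w u/|σ_w u|)^{n_w} |σ_w u|^{i t_w}` for suitable
`n_w ∈ ℤ`, `t_w ∈ ℝ`: the torsion `μ(K) = ⟨ζ⟩` is matched by the exponent `n` at one place
(`σ(ζ)` is a primitive root of unity of order `#μ(K)`), and the free part by the `t_w`, because
the logarithmic vectors of a fundamental system of units form a basis of the full lattice
`unitLattice K ⊂ ℝ^{r₁+r₂-1}` (Dirichlet), hence an `ℝ`-basis, so that a linear functional takes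
prescribed values on them.  (This replaces the Pontryagin-duality step "characters of the discrete
subgroup `𝓞_Kˣ ⊂ (K ⊗ ℝ)ˣ` extend" in the derivation of `HewittRoss_heckeCharacter_extension_quadratic`.)
[cite: NeukirchANT1999, Ch. I §7 Thm. (7.3) (Dirichlet's unit theorem)] -/
theorem exists_archParams_prod_archUnitaryValue_unit_eq (g : (𝓞 K)ˣ →* ℂˣ)
    (hg : ∀ u, ‖(g u : ℂ)‖ = 1) :
    ∃ (n : InfinitePlace K → ℤ) (t : InfinitePlace K → ℝ), ∀ u : (𝓞 K)ˣ,
      ∏ w : InfinitePlace K, archUnitaryValue (n w) (t w) (w.embedding ((u : 𝓞 K) : K)) = g u := by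
  classical
  -- notation
  set emb : (𝓞 K)ˣ → InfinitePlace K → ℂ := fun u w => w.embedding ((u : 𝓞 K) : K) with hemb
  have hemb0 : ∀ u w, emb u w ≠ 0 := fun u w =>
    (map_ne_zero _).mpr (by exact_mod_cast Units.ne_zero u)
  have hnorm : ∀ u w, ‖emb u w‖ = w ((u : 𝓞 K) : K) := fun u w => InfinitePlace.norm_embedding_eq w _
  have hpos : ∀ u w, 0 < ‖emb u w‖ := fun u w => norm_pos_iff.mpr (hemb0 u w)
  have hemb_mul : ∀ u v w, emb (u * v) w = emb u w * emb v w := fun u v w => by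
    simp only [hemb, Units.val_mul, map_mul]
  -- the torsion: a generator `ζ` of `μ(K)`, of order `d`, and a primitive root of unity `σ ζ`
  obtain ⟨ζ, hζ⟩ := IsCyclic.exists_generator (α := torsion K)
  set d := orderOf (ζ : (𝓞 K)ˣ) with hd
  have hdpos : 0 < d := by
    rw [hd, Subgroup.orderOf_coe]
    exact orderOf_pos ζ
  haveI : NeZero d := ⟨hdpos.ne'⟩
  set w₁ : InfinitePlace K := w₀ with hw₁
  have hprim : IsPrimitiveRoot (emb (ζ : (𝓞 K)ˣ) w₁) d := by
    have h1 : IsPrimitiveRoot ((ζ : (𝓞 K)ˣ)) d := IsPrimitiveRoot.orderOf _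
    have h2 : IsPrimitiveRoot (((ζ : (𝓞 K)ˣ) : 𝓞 K)) d := IsPrimitiveRoot.coe_units_iff.mpr h1
    have h3 : IsPrimitiveRoot ((((ζ : (𝓞 K)ˣ) : 𝓞 K) : K)) d :=
      h2.map_of_injective (f := algebraMap (𝓞 K) K) (FaithfulSMul.algebraMap_injective (𝓞 K) K)
    exact h3.map_of_injective (f := w₁.embedding) w₁.embedding.injective
  have hgζ : ((g (ζ : (𝓞 K)ˣ) : ℂ)) ^ d = 1 := by
    rw [← Units.val_pow_eq_pow_val, ← map_pow, hd, pow_orderOf_eq_one, map_one, Units.val_one]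
  obtain ⟨j, -, hj⟩ := hprim.eq_pow_of_pow_eq_one hgζ
  -- the exponents: `j` at `w₁`, `0` elsewhere; the angular part `A`
  set n : InfinitePlace K → ℤ := fun w => if w = w₁ then (j : ℤ) else 0 with hn
  set A : (𝓞 K)ˣ → ℂ := fun u => ∏ w : InfinitePlace K, (emb u w / (‖emb u w‖ : ℂ)) ^ n w with hA
  have hA_eq : ∀ u, A u = (emb u w₁ / (‖emb u w₁‖ : ℂ)) ^ (j : ℤ) := by
    intro u
    rw [hA]
    dsimp only
    rw [Finset.prod_eq_single w₁ (fun w _ hw => by rw [hn]; dsimp only; rw [if_neg hw, zpow_zero])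
      (fun h => absurd (Finset.mem_univ w₁) h)]
    simp [hn]
  have hA_norm : ∀ u, ‖A u‖ = 1 := by
    intro u
    rw [hA_eq, norm_zpow, norm_div, Complex.norm_real, Real.norm_of_nonneg (norm_nonneg _),
      div_self (hpos u w₁).ne', one_zpow]
  have hA0 : ∀ u, A u ≠ 0 := fun u => norm_ne_zero_iff.mp (by rw [hA_norm]; exact one_ne_zero)
  -- the real basis of logarithmic vectors and the linear functional with prescribed values
  set B := (basisUnitLattice K).ofZLatticeBasis ℝ (unitLattice K) with hB
  set θ : Fin (rank K) → ℝ := fun i => Complex.arg ((g (fundSystem K i) : ℂ) / A (fundSystem K i))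
    with hθ
  set ℓ : logSpace K →ₗ[ℝ] ℝ := B.constr ℝ θ with hℓ
  have hℓB : ∀ i, ℓ (B i) = θ i := fun i => by rw [hℓ]; exact B.constr_basis ℝ θ i
  set c : {w : InfinitePlace K // w ≠ w₀} → ℝ := fun w => ℓ (fun w' => if w = w' then 1 else 0) with hc
  have hℓ_apply : ∀ x : logSpace K, ℓ x = ∑ w, x w * c w := fun x => by
    rw [LinearMap.pi_apply_eq_sum_univ ℓ x]
    rfl
  set t : InfinitePlace K → ℝ := fun v => if h : v = w₀ then 0 else (v.mult : ℝ) * c ⟨v, h⟩ with ht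
  -- the modulus part `M u = exp(i ℓ(log u))`
  have hsum : ∀ u : (𝓞 K)ˣ, ∑ w : InfinitePlace K, t w * Real.log (w ((u : 𝓞 K) : K)) =
      ℓ (logEmbedding K (Additive.ofMul u)) := by
    intro u
    rw [hℓ_apply, Fintype.sum_eq_add_sum_subtype_ne _ w₀]
    have h0 : t w₀ * Real.log (w₀ ((u : 𝓞 K) : K)) = 0 := by rw [ht]; simp
    rw [h0, zero_add]
    refine Finset.sum_congr rfl fun w _ => ?_
    rw [logEmbedding_component, ht]
    dsimp only
    rw [dif_neg w.2]
    ring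
  have hM : ∀ u : (𝓞 K)ˣ, ∏ w : InfinitePlace K, ((‖emb u w‖ : ℂ)) ^ ((t w : ℂ) * Complex.I) =
      Complex.exp ((ℓ (logEmbedding K (Additive.ofMul u)) : ℂ) * Complex.I) := by
    intro u
    rw [← hsum u, Complex.ofReal_sum, Finset.sum_mul, Complex.exp_sum]
    refine Finset.prod_congr rfl fun w _ => ?_
    rw [Complex.cpow_def_of_ne_zero (by exact_mod_cast (hpos u w).ne'), ← Complex.ofReal_log (hpos u w).le,
      hnorm]
    push_cast
    ring_nf
  -- the product character `G` and its values on the generators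
  have hG : ∀ u, ∏ w : InfinitePlace K, archUnitaryValue (n w) (t w) (emb u w) =
      A u * Complex.exp ((ℓ (logEmbedding K (Additive.ofMul u)) : ℂ) * Complex.I) := by
    intro u
    rw [← hM u, hA]
    dsimp only
    rw [← Finset.prod_mul_distrib]
    rfl
  have hGζ : ∏ w : InfinitePlace K, archUnitaryValue (n w) (t w) (emb (ζ : (𝓞 K)ˣ) w) = g (ζ : (𝓞 K)ˣ) := by
    rw [hG, (logEmbedding_eq_zero_iff (K := K)).mpr (ζ.2), map_zero, Complex.ofReal_zero, zero_mul,
      Complex.exp_zero, mul_one, hA_eq, ← hj]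
    have h1 : (‖emb (ζ : (𝓞 K)ˣ) w₁‖ : ℂ) = 1 := by
      rw [hnorm, (mem_torsion (K := K)).mp ζ.2 w₁]; simp
    rw [h1, div_one, zpow_natCast]
  have hGf : ∀ i, ∏ w : InfinitePlace K, archUnitaryValue (n w) (t w) (emb (fundSystem K i) w) =
      g (fundSystem K i) := by
    intro i
    rw [hG]
    have hlog : (logEmbedding K (Additive.ofMul (fundSystem K i)) : logSpace K) = B i := by
      rw [logEmbedding_fundSystem, hB, Module.Basis.ofZLatticeBasis_apply]
    rw [hlog, hℓB, hθ]
    dsimp only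
    set z : ℂ := (g (fundSystem K i) : ℂ) / A (fundSystem K i) with hz
    have hz1 : ‖z‖ = 1 := by rw [hz, norm_div, hg, hA_norm, div_one]
    have hz_eq : Complex.exp ((Complex.arg z : ℂ) * Complex.I) = z := by
      have := Complex.norm_mul_exp_arg_mul_I z
      rwa [hz1, Complex.ofReal_one, one_mul] at this
    rw [hz_eq, hz, mul_div_cancel₀ _ (hA0 _)]
  -- both sides are characters of `𝓞_Kˣ` agreeing on `ζ` and on the fundamental system
  refine ⟨n, t, fun u => ?_⟩
  have hne : ∀ u, ∏ w : InfinitePlace K, archUnitaryValue (n w) (t w) (emb u w) ≠ 0 := fun u =>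
    Finset.prod_ne_zero_iff.mpr fun w _ => archUnitaryValue_ne_zero (hemb0 u w) _ _
  let Gm : (𝓞 K)ˣ →* ℂ :=
    { toFun := fun u => ∏ w : InfinitePlace K, archUnitaryValue (n w) (t w) (emb u w)
      map_one' := by
        refine Finset.prod_eq_one fun w _ => ?_
        have : emb 1 w = 1 := by simp [hemb]
        rw [this]; simp [archUnitaryValue]
      map_mul' := fun u v => by
        rw [← Finset.prod_mul_distrib]
        refine Finset.prod_congr rfl fun w _ => ?_
        rw [hemb_mul, archUnitaryValue_mul (hemb0 u w) (hemb0 v w)] }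
  have hGm : ∀ u, Gm u = ∏ w : InfinitePlace K, archUnitaryValue (n w) (t w) (emb u w) := fun u => rfl
  let Gu : (𝓞 K)ˣ →* ℂˣ := Gm.toHomUnits
  have hGu : ∀ u, ((Gu u : ℂˣ) : ℂ) = Gm u := fun u => rfl
  suffices h : Gu u = g u by
    have := congrArg (fun x : ℂˣ => (x : ℂ)) h
    simpa only [hGu, hGm] using this
  obtain ⟨⟨ζ', e⟩, hu, -⟩ := exist_unique_eq_mul_prod K u
  obtain ⟨a, ha⟩ := Subgroup.mem_zpowers_iff.mp (hζ ζ')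
  have hζ' : (ζ' : (𝓞 K)ˣ) = (ζ : (𝓞 K)ˣ) ^ a := by
    have := congrArg (fun x : torsion K => (x : (𝓞 K)ˣ)) ha
    simpa using this.symm
  have h1 : Gu (ζ : (𝓞 K)ˣ) = g (ζ : (𝓞 K)ˣ) := Units.ext (by rw [hGu, hGm]; exact hGζ)
  have h2 : ∀ i, Gu (fundSystem K i) = g (fundSystem K i) := fun i =>
    Units.ext (by rw [hGu, hGm]; exact hGf i)
  rw [hu]
  dsimp only
  rw [map_mul, map_mul, map_prod, map_prod, hζ', map_zpow, map_zpow, h1]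
  congr 1
  exact Finset.prod_congr rfl fun i _ => by rw [map_zpow, map_zpow, h2]

end DirichletFreedom

namespace HeckeCharacter

variable {F₀ K : Type} [Field F₀] [NumberField F₀] [Field K] [NumberField K] [Algebra F₀ K]

/-! ### §2. Bookkeeping: principal triples, the norm-one unit `k / c k`, the infinite part -/

namespace QuadraticExtension

/-- If `a_K · y = (k)` then `y / (c • y) = (k / c k)` as ideles (the base change `a_K` is fixed by
`c`). [folklore] -/
theorem mul_smul_inv_eq_principalIdele (c : K ≃ₐ[F₀] K) {a : ideleGroup F₀} {y : ideleGroup K} {k : Kˣ}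
    (h : AdeleRing.ideleBaseChange F₀ K a * y = principalIdele K k) :
    y * (c • y)⁻¹ = principalIdele K (k * (Units.map (c : K →+* K).toMonoidHom k)⁻¹) := by
  have hcy : AdeleRing.ideleBaseChange F₀ K a * (c • y) =
      principalIdele K (Units.map (c : K →+* K).toMonoidHom k) := by
    rw [← CMQuadraticExtension.smul_principalIdele, ← h, smul_mul', AdeleRing.smul_ideleBaseChange]
  rw [map_mul, map_inv, ← h, ← hcy, ← div_eq_mul_inv, ← div_eq_mul_inv, mul_div_mul_left_eq_div]

/-- For a principal triple `a_K · y = (k)` with `y` a unit idele, `k / c k` is a global unit.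
[folklore] -/
theorem exists_units_eq_div_conj (c : K ≃ₐ[F₀] K) {a : ideleGroup F₀} {y : ideleGroup K} {k : Kˣ}
    (hy : y ∈ unitIdeles K) (h : AdeleRing.ideleBaseChange F₀ K a * y = principalIdele K k) :
    ∃ ε : (𝓞 K)ˣ, Units.map (algebraMap (𝓞 K) K : 𝓞 K →* K) ε =
      k * (Units.map (c : K →+* K).toMonoidHom k)⁻¹ := by
  have hunit : principalIdele K (k * (Units.map (c : K →+* K).toMonoidHom k)⁻¹) ∈ unitIdeles K := by
    rw [← mul_smul_inv_eq_principalIdele c h]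
    exact (unitIdeles K).mul_mem hy ((unitIdeles K).inv_mem (CMQuadraticExtension.smul_mem_unitIdeles c hy))
  obtain ⟨ε, hε⟩ := exists_units_eq_of_mem_unitIdeles hunit
  exact ⟨ε, Units.ext hε⟩

omit [NumberField F₀] in
/-- The infinite part of `c • y` is `c •` the infinite part of `y`. [folklore] -/
theorem infPart_smul (c : K ≃ₐ[F₀] K) (y : ideleGroup K) :
    infPart K (c • y) = Units.map (MulSemiringAction.toRingHom (K ≃ₐ[F₀] K) (InfiniteAdeleRing K) c).toMonoidHom
      (infPart K y) := by
  apply Units.ext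
  rw [val_infPart, AdeleRing.coe_smul_units, AdeleRing.smul_fst, Units.coe_map]
  rfl

variable (S : Finset (HeightOneSpectrum (𝓞 K))) (E : HeightOneSpectrum (𝓞 K) → ℕ)

omit [NumberField F₀] [Algebra F₀ K] in
/-- Membership in `V = 𝕌_K ∩ W_𝔣` of an idele with trivial infinite part only depends on the finite
components. [folklore] -/
theorem mem_nbhd_of_snd_eq_of_fst_eq_one {z z' : ideleGroup K}
    (h : ∀ u, (z : AdeleRing (𝓞 K) K).2 u = (z' : AdeleRing (𝓞 K) K).2 u)
    (h1 : (z' : AdeleRing (𝓞 K) K).1 = 1)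
    (hz : z ∈ (unitIdeles K ⊓ congruenceIdeles (modulusIdeal S E) : Subgroup (ideleGroup K))) :
    z' ∈ (unitIdeles K ⊓ congruenceIdeles (modulusIdeal S E) : Subgroup (ideleGroup K)) := by
  refine ⟨fun u => ?_, fun u hu => ?_, fun w hw => ?_⟩
  · rw [← h]; exact hz.1 u
  · rw [← h]; exact hz.2.1 u hu
  · rw [h1]
    have e1 : (1 : InfiniteAdeleRing K) w = 1 := rfl
    change 0 < InfinitePlace.Completion.extensionEmbeddingOfIsReal hw ((1 : InfiniteAdeleRing K) w)
    rw [e1, map_one]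
    exact one_pos

variable (χ₀ : HeckeCharacter F₀)

/-- **The key identity for triples with `k ∈ F₀`** (general signatures; cf.
`CMQuadraticExtension.key_of_mem_range` for `K` totally complex).  With `V = 𝕌_K ∩ W_𝔣`,
`Φ ∘ BC = χ₀` on `(F₀ ⊗ ℝ)ˣ` (`hα`) and `χ₀(b) = 1` for `b_∞ = 1`, `b_K ∈ V` (`hβ`): if
`a_K · y = (k₀)_K` with `y ∈ V`, `k₀ ∈ F₀ˣ`, then `χ₀(a) Φ(y_∞) = 1`. [cite: Weil1956, §1] -/
theorem key_of_mem_range'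
    (Φ : (InfiniteAdeleRing K)ˣ →ₜ* ℂˣ)
    (hα : ∀ x : (InfiniteAdeleRing F₀)ˣ,
      (Φ (infPart K (AdeleRing.ideleBaseChange F₀ K (infiniteIdeles F₀ x))) : ℂ) = χ₀ (infiniteIdeles F₀ x))
    (hβ : ∀ b : ideleGroup F₀, (b : AdeleRing (𝓞 F₀) F₀).1 = 1 →
      AdeleRing.ideleBaseChange F₀ K b ∈
        (unitIdeles K ⊓ congruenceIdeles (modulusIdeal S E) : Subgroup (ideleGroup K)) → χ₀ b = 1)
    {a : ideleGroup F₀} {y : ideleGroup K} (k₀ : F₀ˣ)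
    (hyV : y ∈ (unitIdeles K ⊓ congruenceIdeles (modulusIdeal S E) : Subgroup (ideleGroup K)))
    (h : AdeleRing.ideleBaseChange F₀ K a * y = AdeleRing.ideleBaseChange F₀ K (principalIdele F₀ k₀)) :
    (χ₀ a : ℂ) * Φ (infPart K y) = 1 := by
  set BC := AdeleRing.ideleBaseChange F₀ K with hBC
  set b : ideleGroup F₀ := a⁻¹ * principalIdele F₀ k₀ with hb
  have hyb : y = BC b := by rw [hb, map_mul, map_inv, ← h, inv_mul_cancel_left]
  set binf : ideleGroup F₀ := infiniteIdeles F₀ (infPart F₀ b) with hbinf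
  set bf : ideleGroup F₀ := binf⁻¹ * b with hbf
  obtain ⟨hbf1, hbf2⟩ := infiniteIdeles_infPart_inv_mul b
  have hb_eq : b = binf * bf := by rw [hbf, mul_inv_cancel_left]
  have hBCbf1 : ((BC bf : ideleGroup K) : AdeleRing (𝓞 K) K).1 = 1 := by
    rw [hBC, AdeleRing.coe_ideleBaseChange, AdeleRing.baseChange_fst, hbf1, map_one]
  have hbfV : BC bf ∈ (unitIdeles K ⊓ congruenceIdeles (modulusIdeal S E) : Subgroup (ideleGroup K)) := by
    refine mem_nbhd_of_snd_eq_of_fst_eq_one S E (z := BC b) (fun u => ?_) hBCbf1 (hyb ▸ hyV)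
    rw [hBC, AdeleRing.coe_ideleBaseChange, AdeleRing.coe_ideleBaseChange, AdeleRing.baseChange_snd,
      AdeleRing.baseChange_snd, FiniteAdeleRing.baseChange_apply, FiniteAdeleRing.baseChange_apply, hbf2]
  have hχbf : χ₀ bf = 1 := hβ bf hbf1 hbfV
  have hinf_bf : infPart K (BC bf) = 1 := by
    apply Units.ext
    rw [val_infPart, hBCbf1, Units.val_one]
  have hΦy : (Φ (infPart K y) : ℂ) = χ₀ binf := by
    rw [hyb, hb_eq, map_mul, map_mul, hinf_bf, mul_one, hbinf]
    exact hα _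
  have hχb : χ₀ b = χ₀ binf := by rw [hb_eq, map_mul, hχbf, mul_one]
  have hχa : χ₀ b = (χ₀ a)⁻¹ := by
    rw [hb, map_mul, map_inv, χ₀.map_principal (principalIdele_mem k₀), mul_one]
  rw [hΦy, ← hχb, hχa, Units.val_inv_eq_inv_val, mul_inv_cancel₀]
  exact Units.ne_zero _

end QuadraticExtension

/-! ### §3. The engine: from an archimedean character `Φ` with `Φ ∘ BC_∞ = χ₀,∞` to the extension -/

open QuadraticExtension in
/-- **Extension of a unitary idele class character along a quadratic extension, with prescribed
unramifiedness, from an archimedean character over `χ₀,∞`** (the general engine; Weil's method with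
the archimedean freedom supplied by Dirichlet's unit theorem instead of Pontryagin duality).  Let
`K/F₀` be quadratic with non-trivial automorphism `c`, `χ₀` a unitary Hecke character of `F₀`, `U` a
set of finite places of `K` with `χ₀` unramified below `u` whenever `u, c • u ∈ U`, and `Φ` a unitary
continuous character of `(K ⊗ ℝ)ˣ` with `Φ((x_K)_∞) = χ₀((x, 1))` for every infinite idele `x` of `F₀`.
Then there is a unitary Hecke character `χ` of `K` with `χ ∘ BC = χ₀`, unramified on `U`.
Proof: on `BC(𝕀_{F₀}) · V`, `V = 𝕌_K ∩ W_𝔣` (`𝔣` above the ramification of `χ₀`, off `U`), the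
character `a_K y ↦ χ₀(a) Φ'(y_∞)` is to kill the principal ideles `(k) = a_K y`; for `Φ' = Φ` it does
so when `c k = k` (`key_of_mem_range'`), so its value is a unitary character `f̄` of the norm-one
units `k / c k` (`(k/ck) = y / c • y ∈ 𝕌_K`); replacing `Φ` by `Φ' = Φ · (ψ ∘ (z ↦ z / c • z))`,
which does not change `Φ ∘ BC_∞`, multiplies this value by `ψ((k / c k)_∞)`, and by
`exists_archParams_prod_archUnitaryValue_unit_eq` the product-form `ψ` can be chosen with
`ψ((ε)_∞) = f̄(ε)⁻¹` on these units; Weil's extension principle (`exists_extension_of_key`) then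
produces `χ`, equal to `Φ' ∘ (·)_∞` on `V ∋` the local units at `u ∈ U`.
[cite: Weil1956, §1] [cite: HewittRoss1979, Thm. (24.12)] -/
theorem exists_extension_quadratic_of_archChar
    (F₀ K : Type) [Field F₀] [NumberField F₀] [Field K] [NumberField K] [Algebra F₀ K]
    (c : K ≃ₐ[F₀] K) (h2 : Module.finrank F₀ K = 2) (hc : c ≠ 1)
    (χ₀ : HeckeCharacter F₀) (hχ₀ : χ₀.IsUnitary)
    (Φ : (InfiniteAdeleRing K)ˣ →ₜ* ℂˣ) (hΦ : ∀ z, ‖(Φ z : ℂ)‖ = 1)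
    (hα : ∀ x : (InfiniteAdeleRing F₀)ˣ,
      (Φ (infPart K (AdeleRing.ideleBaseChange F₀ K (infiniteIdeles F₀ x))) : ℂ) = χ₀ (infiniteIdeles F₀ x))
    (U : Set (HeightOneSpectrum (𝓞 K)))
    (hU : ∀ u ∈ U, c • u ∈ U → χ₀.IsUnramifiedAt (u.under (𝓞 F₀))) :
    ∃ χ : HeckeCharacter K, χ.IsUnitary ∧
      (∀ x, χ (AdeleRing.ideleBaseChange F₀ K x) = χ₀ x) ∧ ∀ u ∈ U, χ.IsUnramifiedAt u := by
  classical
  set BC := AdeleRing.ideleBaseChange F₀ K with hBC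
  haveI := CMQuadraticExtension.isGalois (F₀ := F₀) (K := K) h2
  -- STEP 1: a module of definition of `χ₀` supported on its ramified places
  set T₀ : Finset (HeightOneSpectrum (𝓞 F₀)) := (HeckeCharacter.finite_ramifiedPlaces_holds χ₀).toFinset
    with hT₀
  obtain ⟨e₀, hmod⟩ := HeckeCharacter.exists_isModulus_of_ramified χ₀
  have hT₀mem : ∀ v, v ∈ T₀ ↔ ¬ χ₀.IsUnramifiedAt v := fun v => by
    rw [hT₀, Set.Finite.mem_toFinset]; rfl
  -- STEP 2: the finite set `S` of places above `T₀` and outside `U`, the exponents `E`, `V`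
  have hfinT : {u : HeightOneSpectrum (𝓞 K) | u.under (𝓞 F₀) ∈ T₀}.Finite := by
    have ht := HeightOneSpectrum.tendsto_under_cofinite (𝓞 F₀) (B := 𝓞 K)
    have := ht (T₀.finite_toSet.compl_mem_cofinite)
    rw [Filter.mem_map, Filter.mem_cofinite, Set.preimage_compl, compl_compl] at this
    exact this
  set S : Finset (HeightOneSpectrum (𝓞 K)) := (hfinT.subset (fun u (hu : u.under (𝓞 F₀) ∈ T₀ ∧ u ∉ U) =>
    hu.1) : {u | u.under (𝓞 F₀) ∈ T₀ ∧ u ∉ U}.Finite).toFinset with hSdef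
  have hSmem : ∀ u, u ∈ S ↔ u.under (𝓞 F₀) ∈ T₀ ∧ u ∉ U := fun u => by
    rw [hSdef, Set.Finite.mem_toFinset]; rfl
  have hSU : ∀ u ∈ U, u ∉ S := fun u hu h => ((hSmem u).mp h).2 hu
  have hS : ∀ v ∈ T₀, ∃ u ∈ S, u.under (𝓞 F₀) = v := by
    intro v hv
    obtain ⟨u₀, hu₀⟩ := HeightOneSpectrum.under_surjective (A := 𝓞 F₀) (B := 𝓞 K) v
    replace hu₀ : u₀.under (𝓞 F₀) = v := hu₀
    by_cases h₁ : u₀ ∈ U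
    · by_cases h₂ : c • u₀ ∈ U
      · exact absurd (hu₀ ▸ hU u₀ h₁ h₂) ((hT₀mem v).mp hv)
      · have hcu : (c • u₀).under (𝓞 F₀) = v := by
          rw [HeightOneSpectrum.under_algEquiv_smul]; exact hu₀
        exact ⟨c • u₀, (hSmem _).mpr ⟨by rw [hcu]; exact hv, h₂⟩, hcu⟩
    · exact ⟨u₀, (hSmem _).mpr ⟨by rw [hu₀]; exact hv, h₁⟩, hu₀⟩
  set E : HeightOneSpectrum (𝓞 K) → ℕ := fun u =>
    e₀ (u.under (𝓞 F₀)) * (u.under (𝓞 F₀)).asIdeal.ramificationIdx' u.asIdeal with hE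
  set V : Subgroup (ideleGroup K) := unitIdeles K ⊓ congruenceIdeles (modulusIdeal S E) with hV
  have hVnhds : (V : Set (ideleGroup K)) ∈ 𝓝 (1 : ideleGroup K) := CMQuadraticExtension.nbhd_mem_nhds_one S E
  have hβ : ∀ b : ideleGroup F₀, (b : AdeleRing (𝓞 F₀) F₀).1 = 1 → BC b ∈ V → χ₀ b = 1 :=
    fun b hb1 hbV => CMQuadraticExtension.map_eq_one_of_baseChange_mem_nbhd χ₀ S E hmod hS
      (fun u _ => le_rfl) b hb1 hbV
  -- STEP 3: the admissible triples `(a, y, k)`, `a_K y = (k)`, `y ∈ V`, and `ρ(a, y, k) = k / c k`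
  set cK : Kˣ →* Kˣ := Units.map (c : K →+* K).toMonoidHom with hcK
  let G := ideleGroup F₀ × ideleGroup K × Kˣ
  set Ssub : Subgroup G :=
    { carrier := {t | t.2.1 ∈ V ∧ BC t.1 * t.2.1 = principalIdele K t.2.2}
      one_mem' := ⟨V.one_mem, by simp [map_one]⟩
      mul_mem' := fun {t t'} ht ht' => ⟨V.mul_mem ht.1 ht'.1, by
        change BC (t.1 * t'.1) * (t.2.1 * t'.2.1) = principalIdele K (t.2.2 * t'.2.2)
        rw [map_mul, map_mul, ← ht.2, ← ht'.2, mul_mul_mul_comm]⟩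
      inv_mem' := fun {t} ht => ⟨V.inv_mem ht.1, by
        change BC t.1⁻¹ * t.2.1⁻¹ = principalIdele K t.2.2⁻¹
        rw [map_inv, map_inv, ← ht.2, mul_inv]⟩ } with hSsub
  set ρ : G →* Kˣ :=
    { toFun := fun t => t.2.2 * (cK t.2.2)⁻¹
      map_one' := by simp
      map_mul' := fun t t' => by
        change (t.2.2 * t'.2.2) * (cK (t.2.2 * t'.2.2))⁻¹ = (t.2.2 * (cK t.2.2)⁻¹) * (t'.2.2 * (cK t'.2.2)⁻¹)
        rw [map_mul, mul_inv, mul_mul_mul_comm] } with hρ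
  have hρ_apply : ∀ t : G, ρ t = t.2.2 * (cK t.2.2)⁻¹ := fun t => rfl
  -- the values `val_Θ t = χ₀(a) Θ(y_∞)` for an archimedean character `Θ`
  have hval_mul : ∀ (Θ : (InfiniteAdeleRing K)ˣ →ₜ* ℂˣ) (t t' : G),
      (χ₀ (t * t').1 : ℂ) * Θ (infPart K (t * t').2.1) =
        ((χ₀ t.1 : ℂ) * Θ (infPart K t.2.1)) * ((χ₀ t'.1 : ℂ) * Θ (infPart K t'.2.1)) := by
    intro Θ t t'
    change (χ₀ (t.1 * t'.1) : ℂ) * Θ (infPart K (t.2.1 * t'.2.1)) = _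
    rw [map_mul, map_mul, map_mul, Units.val_mul, Units.val_mul, mul_mul_mul_comm]
  -- (a) `val_Φ` kills the triples with `ρ t = 1` (`k ∈ F₀`)
  have hfixed : ∀ (Θ : (InfiniteAdeleRing K)ˣ →ₜ* ℂˣ),
      (∀ x : (InfiniteAdeleRing F₀)ˣ,
        (Θ (infPart K (BC (infiniteIdeles F₀ x))) : ℂ) = χ₀ (infiniteIdeles F₀ x)) →
      ∀ t ∈ Ssub, ρ t = 1 → (χ₀ t.1 : ℂ) * Θ (infPart K t.2.1) = 1 := by
    intro Θ hΘ t ht hρt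
    obtain ⟨hyV, h⟩ := ht
    have hck : c (t.2.2 : K) = t.2.2 := by
      have := congrArg (fun u : Kˣ => (u : K)) hρt
      simp only [hρ_apply, Units.val_one, Units.val_mul, Units.val_inv_eq_inv_val] at this
      rw [mul_inv_eq_one₀ (Units.ne_zero _)] at this
      exact this.symm
    obtain ⟨k₀', hk₀'⟩ := CMQuadraticExtension.exists_algebraMap_eq_of_apply_eq c h2 hc hck
    have hk₀0 : k₀' ≠ 0 := by rintro rfl; exact t.2.2.ne_zero (by rw [← hk₀', map_zero])
    set k₀ : F₀ˣ := Units.mk0 k₀' hk₀0 with hk₀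
    have hkk : principalIdele K t.2.2 = BC (principalIdele F₀ k₀) := by
      rw [← CMQuadraticExtension.principalIdele_algebraMap]
      congr 1
      exact Units.ext hk₀'.symm
    exact key_of_mem_range' S E χ₀ Θ hΘ hβ k₀ hyV (h.trans hkk)
  -- (b) hence `val_Φ` only depends on `ρ t`
  have hwd : ∀ t ∈ Ssub, ∀ t' ∈ Ssub, ρ t = ρ t' →
      (χ₀ t.1 : ℂ) * Φ (infPart K t.2.1) = (χ₀ t'.1 : ℂ) * Φ (infPart K t'.2.1) := by
    intro t ht t' ht' hρ'
    have h1 : t * t'⁻¹ ∈ Ssub := Ssub.mul_mem ht (Ssub.inv_mem ht')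
    have h2' : ρ (t * t'⁻¹) = 1 := by rw [map_mul, map_inv, hρ', mul_inv_cancel]
    have := hfixed Φ hα _ h1 h2'
    rw [hval_mul] at this
    have hinv : (χ₀ (t'⁻¹).1 : ℂ) * Φ (infPart K (t'⁻¹).2.1) = ((χ₀ t'.1 : ℂ) * Φ (infPart K t'.2.1))⁻¹ := by
      change (χ₀ (t'.1)⁻¹ : ℂ) * Φ (infPart K (t'.2.1)⁻¹) = _
      rw [map_inv, map_inv, map_inv, Units.val_inv_eq_inv_val, Units.val_inv_eq_inv_val, mul_inv]
    have hne : (χ₀ t'.1 : ℂ) * Φ (infPart K t'.2.1) ≠ 0 :=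
      mul_ne_zero (Units.ne_zero _) (Units.ne_zero _)
    rwa [hinv, mul_inv_eq_one₀ hne] at this
  -- (c) the unitary character `f̄` of `R = ρ(Ssub)` and a unitary extension `F̄` to `Kˣ`
  set R : Subgroup Kˣ := Ssub.map ρ with hR
  have hRex : ∀ r : R, ∃ t, t ∈ Ssub ∧ ρ t = (r : Kˣ) := fun r => Subgroup.mem_map.mp r.2
  choose pre hpre hρpre using hRex
  have hnorm_val : ∀ t : G, ‖(χ₀ t.1 : ℂ) * Φ (infPart K t.2.1)‖ = 1 := fun t => by
    rw [norm_mul, hχ₀, hΦ, mul_one]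
  let fbar : R →* Circle :=
    { toFun := fun r => ⟨(χ₀ (pre r).1 : ℂ) * Φ (infPart K (pre r).2.1),
        mem_sphere_zero_iff_norm.mpr (hnorm_val _)⟩
      map_one' := by
        apply Circle.ext
        change (χ₀ (pre 1).1 : ℂ) * Φ (infPart K (pre 1).2.1) = 1
        rw [hwd _ (hpre 1) 1 Ssub.one_mem (by rw [hρpre, map_one]; rfl)]
        change (χ₀ 1 : ℂ) * Φ (infPart K 1) = 1
        rw [map_one, map_one, map_one, Units.val_one, one_mul]
      map_mul' := fun r r' => by
        apply Circle.ext
        change (χ₀ (pre (r * r')).1 : ℂ) * Φ (infPart K (pre (r * r')).2.1) =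
          ((χ₀ (pre r).1 : ℂ) * Φ (infPart K (pre r).2.1)) *
            ((χ₀ (pre r').1 : ℂ) * Φ (infPart K (pre r').2.1))
        rw [← hval_mul]
        exact hwd _ (hpre _) _ (Ssub.mul_mem (hpre r) (hpre r'))
          (by rw [map_mul, hρpre, hρpre, hρpre]; rfl) }
  have hfbar : ∀ t (ht : t ∈ Ssub), ((fbar ⟨ρ t, Subgroup.mem_map.mpr ⟨t, ht, rfl⟩⟩ : Circle) : ℂ) =
      (χ₀ t.1 : ℂ) * Φ (infPart K t.2.1) := fun t ht =>
    hwd _ (hpre _) t ht (hρpre _)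
  obtain ⟨Fbar, hFbar⟩ := Subgroup.exists_monoidHom_extension Circle.exists_pow_eq R fbar
  -- (d) Dirichlet freedom: a product-form `ψ` with `ψ((ε)_∞) = F̄(ε)⁻¹` on the global units
  set ιU : (𝓞 K)ˣ →* Kˣ := Units.map (algebraMap (𝓞 K) K : 𝓞 K →* K) with hιU
  set g : (𝓞 K)ˣ →* ℂˣ := (Circle.toUnits.comp (Fbar.comp ιU))⁻¹ with hg
  have hg_apply : ∀ u, (g u : ℂ) = ((Fbar (ιU u) : ℂ))⁻¹ := fun u => by
    rw [hg, MonoidHom.inv_apply, Units.val_inv_eq_inv_val]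
    rfl
  have hg1 : ∀ u, ‖(g u : ℂ)‖ = 1 := fun u => by rw [hg_apply, norm_inv, Circle.norm_coe, inv_one]
  obtain ⟨n, tt, hnt⟩ := exists_archParams_prod_archUnitaryValue_unit_eq g hg1
  obtain ⟨ψ, hψ⟩ := exists_continuousMonoidHom_archUnitaryValue (K := K) n tt
  have hι0 : ∀ (z : (InfiniteAdeleRing K)ˣ) (w : InfinitePlace K),
      InfinitePlace.Completion.extensionEmbedding w ((z : InfiniteAdeleRing K) w) ≠ 0 :=
    fun z w => InfiniteIdele.extensionEmbedding_apply_ne_zero z w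
  have hψ1 : ∀ z, ‖(ψ z : ℂ)‖ = 1 := fun z => by
    rw [hψ, norm_prod]
    exact Finset.prod_eq_one fun w _ => norm_archUnitaryValue (hι0 z w) _ _
  have hψ_unit : ∀ ε : (𝓞 K)ˣ, (ψ (globalToInfiniteUnits K (ιU ε)) : ℂ) = ((Fbar (ιU ε) : ℂ))⁻¹ := by
    intro ε
    rw [hψ, ← hg_apply, ← hnt ε]
    refine Finset.prod_congr rfl fun w _ => ?_
    rw [extensionEmbedding_globalToInfiniteUnits]
    rfl
  -- (e) the twist `Ψ(z) = ψ(z / c • z)` and `Φ' = Φ Ψ`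
  set cU : (InfiniteAdeleRing K)ˣ →* (InfiniteAdeleRing K)ˣ :=
    Units.map (MulSemiringAction.toRingHom (K ≃ₐ[F₀] K) (InfiniteAdeleRing K) c).toMonoidHom with hcU
  have hcU_cont : Continuous cU := Continuous.units_map _ (InfiniteAdeleRing.continuous_smul F₀ c)
  set δ : (InfiniteAdeleRing K)ˣ →* (InfiniteAdeleRing K)ˣ := (MonoidHom.id _) / cU with hδ
  have hδ_apply : ∀ z, δ z = z / cU z := fun z => rfl
  have hδ_cont : Continuous δ := by
    change Continuous fun z => z / cU z
    exact continuous_id.div' hcU_cont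
  let Ψ : (InfiniteAdeleRing K)ˣ →ₜ* ℂˣ := ⟨ψ.toMonoidHom.comp δ, ψ.continuous.comp hδ_cont⟩
  have hΨ_apply : ∀ z, Ψ z = ψ (z / cU z) := fun z => rfl
  let Φ' : (InfiniteAdeleRing K)ˣ →ₜ* ℂˣ :=
    ⟨Φ.toMonoidHom * Ψ.toMonoidHom, Φ.continuous.mul Ψ.continuous⟩
  have hΦ'_apply : ∀ z, (Φ' z : ℂ) = (Φ z : ℂ) * Ψ z := fun z => by
    change (((Φ z * Ψ z : ℂˣ)) : ℂ) = _
    rw [Units.val_mul]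
  have hΦ'1 : ∀ z, ‖(Φ' z : ℂ)‖ = 1 := fun z => by rw [hΦ'_apply, norm_mul, hΦ, hΨ_apply, hψ1, mul_one]
  -- `Ψ` kills `BC_∞`, so `Φ' ∘ BC_∞ = χ₀,∞`
  have hΨBC : ∀ x : ideleGroup F₀, Ψ (infPart K (BC x)) = 1 := by
    intro x
    rw [hΨ_apply]
    have : cU (infPart K (BC x)) = infPart K (BC x) := by
      rw [← infPart_smul c (BC x), hBC, AdeleRing.smul_ideleBaseChange]
    rw [this, div_eq_mul_inv, mul_inv_cancel, map_one]
  have hα' : ∀ x : (InfiniteAdeleRing F₀)ˣ,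
      (Φ' (infPart K (BC (infiniteIdeles F₀ x))) : ℂ) = χ₀ (infiniteIdeles F₀ x) := fun x => by
    rw [hΦ'_apply, hΨBC, Units.val_one, mul_one, hα]
  -- the shift formula: on admissible triples `Ψ(y_∞) = ψ((k / c k)_∞)`
  have hshift : ∀ t ∈ Ssub, Ψ (infPart K t.2.1) = ψ (globalToInfiniteUnits K (ρ t)) := by
    intro t ht
    rw [hΨ_apply, ← infPart_smul c, div_eq_mul_inv, ← map_inv, ← map_mul,
      mul_smul_inv_eq_principalIdele c ht.2, infPart_principalIdele]
    rfl
  -- (f) `val_{Φ'}` kills every admissible triple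
  have hkey : ∀ t ∈ Ssub, (χ₀ t.1 : ℂ) * Φ' (infPart K t.2.1) = 1 := by
    intro t ht
    obtain ⟨ε, hε⟩ := exists_units_eq_div_conj c (V.toSubmonoid.toSubsemigroup.mem_carrier.mp ht.1).1 ht.2
    have hρε : ρ t = ιU ε := by rw [hρ_apply, hιU, hε]
    rw [hΦ'_apply, ← mul_assoc, hshift t ht, hρε, hψ_unit ε, ← hρε, ← hfbar t ht]
    have hmem : ρ t ∈ R := Subgroup.mem_map.mpr ⟨t, ht, rfl⟩
    rw [show ((Fbar (ρ t) : Circle) : ℂ) = fbar ⟨ρ t, hmem⟩ by rw [← hFbar ⟨ρ t, hmem⟩]]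
    exact mul_inv_cancel₀ (Circle.coe_ne_zero _)
  -- STEP 4: Weil's extension principle
  obtain ⟨χ, hχu, hχres, hχV⟩ := exists_extension_of_key χ₀ hχ₀ V hVnhds Φ' hΦ'1
    (fun a y k hyV h => hkey (a, y, k) ⟨hyV, h⟩)
  refine ⟨χ, hχu, hχres, fun u hu ε => ?_⟩
  -- STEP 5: unramifiedness at `u ∈ U`: the local units lie in `V`, where `χ = Φ' ∘ (·)_∞ = 1`
  rw [HeckeCharacter.localComponent_apply]
  have hmem := CMQuadraticExtension.localUnits_mem_nbhd S E (hSU u hu) ε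
  apply Units.ext
  rw [hχV _ hmem, Units.val_one]
  have h1 : infPart K (localUnits u (Units.map ((u.adicCompletionIntegers K).subtype : _ →* _) ε)) = 1 := by
    apply Units.ext
    rw [val_infPart, localUnits_fst, Units.val_one]
  rw [h1, map_one, Units.val_one]

/-! ### §4. An archimedean character over `χ₀,∞` for an arbitrary unitary `χ₀` and arbitrary
signatures (place by place: `|·|` and a sign at the places over a real place, transport at the
places over a complex place) -/

namespace QuadraticExtension

omit [NumberField F₀] [NumberField K] in
/-- At an infinite place `w` of `K` above `v = w|_{F₀}`, Mathlib's complex embedding of `K_w`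
restricts along `F₀,v → K_w` to the embedding of `F₀,v` or to its complex conjugate (both are
continuous and extend complex embeddings of `F₀` defining the place `v`). [folklore] -/
theorem extensionEmbedding_infiniteCompletionOfComap_or (w : InfinitePlace K) :
    (∀ y, InfinitePlace.Completion.extensionEmbedding w (infiniteCompletionOfComap F₀ K w y) =
        InfinitePlace.Completion.extensionEmbedding (w.comap (algebraMap F₀ K)) y) ∨
      ∀ y, InfinitePlace.Completion.extensionEmbedding w (infiniteCompletionOfComap F₀ K w y) =
        starRingEnd ℂ (InfinitePlace.Completion.extensionEmbedding (w.comap (algebraMap F₀ K)) y) := by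
  set v := w.comap (algebraMap F₀ K) with hv
  have hplace : InfinitePlace.mk (w.embedding.comp (algebraMap F₀ K)) = InfinitePlace.mk v.embedding := by
    rw [InfinitePlace.mk_embedding, ← InfinitePlace.comap_mk, InfinitePlace.mk_embedding]
  have hcont₁ : Continuous fun y => InfinitePlace.Completion.extensionEmbedding w
      (infiniteCompletionOfComap F₀ K w y) :=
    (InfinitePlace.Completion.isometry_extensionEmbedding w).continuous.comp
      (continuous_infiniteCompletionOfComap F₀ K w)
  have hcont₂ : Continuous fun y => InfinitePlace.Completion.extensionEmbedding v y :=
    (InfinitePlace.Completion.isometry_extensionEmbedding v).continuous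
  rcases InfinitePlace.mk_eq_iff.mp hplace with heq | heq
  · left
    intro y
    refine congrFun (InfinitePlace.Completion.ext_of_coe v hcont₁ hcont₂ fun x => ?_) y
    rw [infiniteCompletionOfComap_coe, InfinitePlace.Completion.extensionEmbedding_coe w (WithAbs.toAbs w.1 _),
      InfinitePlace.Completion.extensionEmbedding_coe v (WithAbs.toAbs v.1 _)]
    exact RingHom.congr_fun heq x
  · right
    intro y
    refine congrFun (InfinitePlace.Completion.ext_of_coe v hcont₁
      (Complex.continuous_conj.comp hcont₂) fun x => ?_) y
    rw [Function.comp_apply, infiniteCompletionOfComap_coe, InfinitePlace.Completion.extensionEmbedding_coe w (WithAbs.toAbs w.1 _),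
      InfinitePlace.Completion.extensionEmbedding_coe v (WithAbs.toAbs v.1 _)]
    have h1 : starRingEnd ℂ (w.embedding (algebraMap F₀ K x)) = v.embedding x := by
      have := RingHom.congr_fun heq x
      rwa [ComplexEmbedding.conjugate_coe_eq] at this
    change w.embedding (algebraMap F₀ K x) = starRingEnd ℂ (v.embedding x)
    rw [← h1, starRingEnd_self_apply]

/-- **An archimedean character over `χ₀,∞`.**  For every unitary Hecke character `χ₀` of `F₀` and
every extension `K/F₀` of number fields there is a unitary continuous character `Φ` of `(K ⊗ ℝ)ˣ`
with `Φ((x_K)_∞) = χ₀((x, 1))` for all infinite ideles `x` of `F₀`.  Construction: choose one place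
`w_v` of `K` above each infinite place `v` of `F₀`; over a real `v` put
`z ↦ χ₀,v(|ι z_{w_v}|) · (ι z_{w_v}/|ι z_{w_v}|)^{b_v}` with `χ₀,v(-1) = (-1)^{b_v}`, over a complex `v`
put `z ↦ χ₀,v(ι_v⁻¹ (τ ι z_{w_v}))` with `τ ∈ {1, conj}` the twist of
`extensionEmbedding_infiniteCompletionOfComap_or`, and `1` at the other places; on `x_K` this is
`∏_v χ₀,v(x_v) = χ₀((x, 1))`. [folklore] -/
theorem exists_archChar_baseChange_eq (χ₀ : HeckeCharacter F₀) (hχ₀ : χ₀.IsUnitary) :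
    ∃ Φ : (InfiniteAdeleRing K)ˣ →ₜ* ℂˣ, (∀ z, ‖(Φ z : ℂ)‖ = 1) ∧
      ∀ x : (InfiniteAdeleRing F₀)ˣ,
        (Φ (infPart K (AdeleRing.ideleBaseChange F₀ K (infiniteIdeles F₀ x))) : ℂ) =
          χ₀ (infiniteIdeles F₀ x) := by
  classical
  -- notation: `ι_w`, the local components `χ₀,v`, the components `x_v` as units
  set ιK : ∀ w : InfinitePlace K, w.Completion →+* ℂ := fun w =>
    InfinitePlace.Completion.extensionEmbedding w with hιK
  set ιF : ∀ v : InfinitePlace F₀, v.Completion →+* ℂ := fun v =>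
    InfinitePlace.Completion.extensionEmbedding v with hιF
  set sing : ∀ v : InfinitePlace F₀, (v.Completion)ˣ →* (InfiniteAdeleRing F₀)ˣ := fun v =>
    Units.map (MonoidHom.mulSingle (fun v : InfinitePlace F₀ => v.Completion) v :
      v.Completion →* InfiniteAdeleRing F₀) with hsing
  set loc : ∀ v : InfinitePlace F₀, (v.Completion)ˣ →* ℂˣ := fun v =>
    χ₀.toContinuousMonoidHom.toMonoidHom.comp ((infiniteIdeles F₀).comp (sing v)) with hloc
  have hloc_apply : ∀ v y, loc v y = χ₀ (infiniteIdeles F₀ (sing v y)) := fun v y => rfl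
  have hloc1 : ∀ v y, ‖(loc v y : ℂ)‖ = 1 := fun v y => hχ₀ _
  have hloc_cont : ∀ v, Continuous (loc v) := by
    intro v
    refine χ₀.toContinuousMonoidHom.continuous.comp ((Continuous.units_map _ ?_).comp (Continuous.units_map _ ?_))
    · exact continuous_id.prodMk continuous_const
    · exact continuous_mulSingle v
  set cpt : ∀ v : InfinitePlace F₀, (InfiniteAdeleRing F₀)ˣ →* (v.Completion)ˣ := fun v =>
    Units.map (Pi.evalMonoidHom (fun v : InfinitePlace F₀ => v.Completion) v) with hcpt
  have hcpt_val : ∀ v (x : (InfiniteAdeleRing F₀)ˣ), ((cpt v x : (v.Completion)ˣ) : v.Completion) =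
      (x : InfiniteAdeleRing F₀) v := fun v x => rfl
  -- `χ₀((x,1)) = ∏_v χ₀,v(x_v)`
  have hdecomp : ∀ x : (InfiniteAdeleRing F₀)ˣ, (χ₀ (infiniteIdeles F₀ x) : ℂ) = ∏ v, (loc v (cpt v x) : ℂ) := by
    intro x
    have hx : x = ∏ v, sing v (cpt v x) := by
      apply Units.ext
      rw [Units.coe_prod]
      change (x : InfiniteAdeleRing F₀) = ∏ v, Pi.mulSingle v ((x : InfiniteAdeleRing F₀) v)
      exact (Finset.univ_prod_mulSingle (x : InfiniteAdeleRing F₀)).symm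
    conv_lhs => rw [hx, map_prod, map_prod, Units.coe_prod]
    exact Finset.prod_congr rfl fun v _ => rfl
  -- the section `s` and the chosen places
  obtain ⟨s, hs⟩ : ∃ s : InfinitePlace F₀ → InfinitePlace K, ∀ v, (s v).comap (algebraMap F₀ K) = v :=
    ⟨fun v => (InfinitePlace.comap_surjective (k := F₀) (K := K) v).choose,
      fun v => (InfinitePlace.comap_surjective (k := F₀) (K := K) v).choose_spec⟩
  set vK : InfinitePlace K → InfinitePlace F₀ := fun w => w.comap (algebraMap F₀ K) with hvK
  have hsv : ∀ v, vK (s v) = v := hs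
  -- `‖ι_w z_w‖` as a unit of `ℝ`
  have hι0 : ∀ (z : (InfiniteAdeleRing K)ˣ) (w : InfinitePlace K), ιK w ((z : InfiniteAdeleRing K) w) ≠ 0 :=
    fun z w => InfiniteIdele.extensionEmbedding_apply_ne_zero z w
  set NC : ∀ w : InfinitePlace K, InfiniteAdeleRing K →* ℝ := fun w =>
    { toFun := fun z => ‖ιK w (z w)‖
      map_one' := by simp
      map_mul' := fun z z' => by
        change ‖ιK w (z w * z' w)‖ = ‖ιK w (z w)‖ * ‖ιK w (z' w)‖
        rw [map_mul, norm_mul] } with hNC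
  have hNC_apply : ∀ w (z : InfiniteAdeleRing K), NC w z = ‖ιK w (z w)‖ := fun w z => rfl
  have hNC_cont : ∀ w, Continuous (NC w) := fun w =>
    continuous_norm.comp ((InfinitePlace.Completion.isometry_extensionEmbedding w).continuous.comp
      (continuous_apply w))
  -- REAL places of `F₀`: `z ↦ χ₀,v(|ι z_{w}|)` for `w = s v`
  set toR : ∀ v : InfinitePlace F₀, v.IsReal → (ℝˣ →* (v.Completion)ˣ) := fun v hv =>
    Units.map ((InfinitePlace.Completion.ringEquivRealOfIsReal hv).symm : ℝ →+* v.Completion).toMonoidHom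
    with htoR
  have htoR_cont : ∀ v (hv : v.IsReal), Continuous (toR v hv) := fun v hv =>
    Continuous.units_map _ (InfinitePlace.Completion.isometryEquivRealOfIsReal hv).symm.continuous
  set modPart : ∀ v : InfinitePlace F₀, v.IsReal → ((InfiniteAdeleRing K)ˣ →* ℂˣ) := fun v hv =>
    (loc v).comp ((toR v hv).comp (Units.map (NC (s v)))) with hmodPart
  have hmodPart_cont : ∀ v (hv : v.IsReal), Continuous (modPart v hv) := fun v hv =>
    (hloc_cont v).comp ((htoR_cont v hv).comp (Continuous.units_map _ (hNC_cont _)))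
  -- COMPLEX places of `F₀`: `z ↦ χ₀,v(ι_v⁻¹ (τ ι z_w))` for `w = s v`
  have hτ : ∀ w : InfinitePlace K, ∃ τ : ℂ →+* ℂ, Continuous τ ∧
      ∀ y, τ (ιK w (infiniteCompletionOfComap F₀ K w y)) = ιF (vK w) y := by
    intro w
    rcases extensionEmbedding_infiniteCompletionOfComap_or (F₀ := F₀) w with h | h
    · exact ⟨RingHom.id ℂ, continuous_id, fun y => by rw [RingHom.id_apply]; exact h y⟩
    · exact ⟨starRingEnd ℂ, Complex.continuous_conj, fun y => by rw [h y, starRingEnd_self_apply]⟩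
  choose τ hτc hτ using hτ
  set J : ∀ w : InfinitePlace K, InfiniteAdeleRing K →+* ℂ := fun w =>
    (τ w).comp ((ιK w).comp (Pi.evalRingHom (fun w : InfinitePlace K => w.Completion) w)) with hJ
  have hJ_apply : ∀ w (z : InfiniteAdeleRing K), J w z = τ w (ιK w (z w)) := fun w z => rfl
  have hJ_cont : ∀ w, Continuous (J w) := fun w =>
    (hτc w).comp ((InfinitePlace.Completion.isometry_extensionEmbedding w).continuous.comp (continuous_apply w))
  set toC : ∀ v : InfinitePlace F₀, v.IsComplex → (ℂˣ →* (v.Completion)ˣ) := fun v hv =>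
    Units.map ((InfinitePlace.Completion.ringEquivComplexOfIsComplex hv).symm : ℂ →+* v.Completion).toMonoidHom
    with htoC
  have htoC_cont : ∀ v (hv : v.IsComplex), Continuous (toC v hv) := fun v hv =>
    Continuous.units_map _ (InfinitePlace.Completion.isometryEquivComplexOfIsComplex hv).symm.continuous
  set cplxPart : ∀ v : InfinitePlace F₀, v.IsComplex → ((InfiniteAdeleRing K)ˣ →* ℂˣ) := fun v hv =>
    (loc v).comp ((toC v hv).comp (Units.map (J (s v)).toMonoidHom)) with hcplxPart
  have hcplxPart_cont : ∀ v (hv : v.IsComplex), Continuous (cplxPart v hv) := fun v hv =>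
    (hloc_cont v).comp ((htoC_cont v hv).comp (Continuous.units_map _ (hJ_cont _)))
  -- the sign exponents `b v` at the real places: `χ₀,v(-1) = (-1)^{b v}`
  have hb' : ∀ v : InfinitePlace F₀, ∃ b : ℕ, (loc v (-1) : ℂ) = (-1) ^ b := by
    intro v
    have hsq : ((loc v (-1) : ℂˣ) : ℂ) ^ 2 = 1 := by
      rw [← Units.val_pow_eq_pow_val, ← map_pow, neg_one_sq, map_one, Units.val_one]
    rcases sq_eq_one_iff.mp hsq with h | h
    · exact ⟨0, by rw [h, pow_zero]⟩
    · exact ⟨1, by rw [h, pow_one]⟩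
  choose b hb using hb'
  set m : InfinitePlace K → ℤ := fun w => if s (vK w) = w ∧ (vK w).IsReal then (b (vK w) : ℤ) else 0 with hm
  obtain ⟨Sgn, hSgn⟩ := exists_continuousMonoidHom_archUnitaryValue (K := K) m (fun _ => 0)
  have hSgn1 : ∀ z, ‖(Sgn z : ℂ)‖ = 1 := fun z => by
    rw [hSgn, norm_prod]
    exact Finset.prod_eq_one fun w _ => norm_archUnitaryValue (hι0 z w) _ _
  -- assembling `Φ`
  set PR : (InfiniteAdeleRing K)ˣ →* ℂˣ := ∏ v : {v : InfinitePlace F₀ // v.IsReal}, modPart v.1 v.2 with hPR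
  set PC : (InfiniteAdeleRing K)ˣ →* ℂˣ := ∏ v : {v : InfinitePlace F₀ // ¬ v.IsReal},
    cplxPart v.1 (InfinitePlace.not_isReal_iff_isComplex.mp v.2) with hPC
  have hPR_apply : ∀ z, PR z = ∏ v : {v : InfinitePlace F₀ // v.IsReal}, modPart v.1 v.2 z := fun z => by
    rw [hPR, MonoidHom.finsetProd_apply]
  have hPC_apply : ∀ z, PC z = ∏ v : {v : InfinitePlace F₀ // ¬ v.IsReal},
      cplxPart v.1 (InfinitePlace.not_isReal_iff_isComplex.mp v.2) z := fun z => by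
    rw [hPC, MonoidHom.finsetProd_apply]
  have hPR_cont : Continuous PR := by
    have : (PR : (InfiniteAdeleRing K)ˣ → ℂˣ) = fun z => ∏ v : {v : InfinitePlace F₀ // v.IsReal},
        modPart v.1 v.2 z := funext hPR_apply
    rw [this]
    exact continuous_finsetProd _ fun v _ => hmodPart_cont v.1 v.2
  have hPC_cont : Continuous PC := by
    have : (PC : (InfiniteAdeleRing K)ˣ → ℂˣ) = fun z => ∏ v : {v : InfinitePlace F₀ // ¬ v.IsReal},
        cplxPart v.1 (InfinitePlace.not_isReal_iff_isComplex.mp v.2) z := funext hPC_apply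
    rw [this]
    exact continuous_finsetProd _ fun v _ => hcplxPart_cont v.1 _
  let Φ : (InfiniteAdeleRing K)ˣ →ₜ* ℂˣ :=
    ⟨PR * PC * Sgn.toMonoidHom, (hPR_cont.mul hPC_cont).mul Sgn.continuous⟩
  have hΦ_apply : ∀ z, (Φ z : ℂ) = (PR z : ℂ) * PC z * Sgn z := fun z => by
    change (((PR z * PC z * Sgn z : ℂˣ)) : ℂ) = _
    rw [Units.val_mul, Units.val_mul]
  have hPR1 : ∀ z, ‖(PR z : ℂ)‖ = 1 := fun z => by
    rw [hPR_apply, Units.coe_prod, norm_prod]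
    exact Finset.prod_eq_one fun v _ => hloc1 _ _
  have hPC1 : ∀ z, ‖(PC z : ℂ)‖ = 1 := fun z => by
    rw [hPC_apply, Units.coe_prod, norm_prod]
    exact Finset.prod_eq_one fun v _ => hloc1 _ _
  refine ⟨Φ, fun z => by rw [hΦ_apply, norm_mul, norm_mul, hPR1, hPC1, hSgn1, one_mul, one_mul], fun x => ?_⟩
  -- the value on `Z = (x_K)_∞`
  set Z : (InfiniteAdeleRing K)ˣ := infPart K (AdeleRing.ideleBaseChange F₀ K (infiniteIdeles F₀ x)) with hZdef
  have hZ : ∀ w, (Z : InfiniteAdeleRing K) w = infiniteCompletionOfComap F₀ K w ((x : InfiniteAdeleRing F₀) (vK w)) := by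
    intro w
    rw [hZdef, val_infPart, AdeleRing.coe_ideleBaseChange, AdeleRing.baseChange_fst, infiniteIdeles_fst,
      InfiniteAdeleRing.baseChange_apply]
  -- real places: `|x_v|` and the sign
  have hreal : ∀ (v : InfinitePlace F₀) (hv : v.IsReal),
      (modPart v hv Z : ℂ) * archUnitaryValue (b v) 0 (ιK (s v) ((Z : InfiniteAdeleRing K) (s v))) =
        loc v (cpt v x) := by
    intro v hv
    set e := InfinitePlace.Completion.ringEquivRealOfIsReal hv with he
    set r : ℝ := e ((x : InfiniteAdeleRing F₀) v) with hr
    -- `ι_{s v}(Z_{s v}) = r`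
    have hvs : (vK (s v)).IsReal := by rw [hsv]; exact hv
    have hιZ : ιK (s v) ((Z : InfiniteAdeleRing K) (s v)) = (r : ℂ) := by
      rw [hZ, hιK]
      dsimp only
      rw [CMQuadraticExtension.extensionEmbedding_infiniteCompletionOfComap (s v) hvs]
      congr 1
      -- transport `x (vK (s v))` to `x v` along `hsv`
      have key : ∀ (v' : InfinitePlace F₀) (_ : v' = v) (hv' : v'.IsReal),
          InfinitePlace.Completion.extensionEmbeddingOfIsReal hv' ((x : InfiniteAdeleRing F₀) v') = r := by
        rintro v' rfl hv'
        rfl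
      exact key _ (hsv v) hvs
    have hr0 : r ≠ 0 := by
      intro h0
      have := hι0 Z (s v)
      rw [hιZ, h0, Complex.ofReal_zero] at this
      exact this rfl
    -- the units `r`, `|r|` of `ℝ`
    set ru : ℝˣ := Units.mk0 r hr0 with hru
    set au : ℝˣ := Units.mk0 |r| (abs_ne_zero.mpr hr0) with hau
    have hNCZ : Units.map (NC (s v)) Z = au := by
      apply Units.ext
      rw [Units.coe_map, hNC_apply, hιZ, Complex.norm_real, Real.norm_eq_abs]
      rfl
    have hmod : modPart v hv Z = loc v (toR v hv au) := by
      change (loc v) ((toR v hv) (Units.map (NC (s v)) Z)) = _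
      rw [hNCZ]
    -- `x_v = e⁻¹ r`
    have hxv : cpt v x = toR v hv ru := by
      apply Units.ext
      rw [hcpt_val]
      change (x : InfiniteAdeleRing F₀) v = e.symm (ru : ℝ)
      rw [hru, Units.val_mk0, hr, RingEquiv.symm_apply_apply]
    have h1 : toR v hv (-1) = -1 := by
      apply Units.ext
      change e.symm ((-1 : ℝˣ) : ℝ) = ((-1 : (v.Completion)ˣ) : v.Completion)
      rw [Units.val_neg, Units.val_one, map_neg, map_one, Units.val_neg, Units.val_one]
    rw [hmod, hιZ, hxv]
    rcases lt_or_gt_of_ne hr0 with hneg | hposr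
    · -- `r < 0`: `r = |r| · (-1)`
      have hru_eq : ru = au * (-1) := by
        apply Units.ext
        rw [Units.val_mul, hru, hau, Units.val_mk0, Units.val_mk0, Units.val_neg, Units.val_one,
          abs_of_neg hneg, mul_neg_one, neg_neg]
      rw [CMQuadraticExtension.archUnitaryValue_ofReal_of_neg hneg, hru_eq, map_mul, map_mul, Units.val_mul, h1,
        hb v, zpow_natCast]
    · -- `r > 0`: `r = |r|`
      have hru_eq : ru = au := by
        apply Units.ext
        rw [hru, hau, Units.val_mk0, Units.val_mk0, abs_of_pos hposr]
      rw [CMQuadraticExtension.archUnitaryValue_ofReal_of_pos hposr, hru_eq, mul_one]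
  -- complex places: transport
  have hcplx : ∀ (v : InfinitePlace F₀) (hv : v.IsComplex), (cplxPart v hv Z : ℂ) = loc v (cpt v x) := by
    intro v hv
    have harg : toC v hv (Units.map (J (s v)).toMonoidHom Z) = cpt v x := by
      apply Units.ext
      rw [hcpt_val]
      change (InfinitePlace.Completion.ringEquivComplexOfIsComplex hv).symm (J (s v) (Z : InfiniteAdeleRing K)) =
        (x : InfiniteAdeleRing F₀) v
      rw [hJ_apply, hZ, hτ]
      have key : ∀ (v' : InfinitePlace F₀) (h : v' = v),
          (InfinitePlace.Completion.ringEquivComplexOfIsComplex hv).symm (ιF v' ((x : InfiniteAdeleRing F₀) v')) =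
            (x : InfiniteAdeleRing F₀) v := by
        rintro v' rfl
        rw [hιF]
        dsimp only
        rw [← InfinitePlace.Completion.ringEquivComplexOfIsComplex_apply hv, RingEquiv.symm_apply_apply]
      exact key _ (hsv v)
    change ((loc v) ((toC v hv) (Units.map (J (s v)).toMonoidHom Z)) : ℂ) = _
    rw [harg]
  -- the sign character on `Z`
  have hSgnZ : (Sgn Z : ℂ) = ∏ v : {v : InfinitePlace F₀ // v.IsReal},
      archUnitaryValue (b v.1) 0 (ιK (s v.1) ((Z : InfiniteAdeleRing K) (s v.1))) := by
    rw [hSgn]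
    -- the factors at the non-chosen or non-real places are `1`
    have hfac : ∀ w, archUnitaryValue (m w) ((fun _ => (0 : ℝ)) w) (ιK w ((Z : InfiniteAdeleRing K) w)) =
        if s (vK w) = w ∧ (vK w).IsReal then
          archUnitaryValue (b (vK w)) 0 (ιK w ((Z : InfiniteAdeleRing K) w)) else 1 := by
      intro w
      rw [hm]
      dsimp only
      split_ifs with h
      · rfl
      · unfold archUnitaryValue
        rw [zpow_zero, one_mul, Complex.ofReal_zero, zero_mul, Complex.cpow_zero]
    rw [Finset.prod_congr rfl fun w _ => hfac w, Finset.prod_ite, Finset.prod_const_one, mul_one]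
    -- reindex the chosen real places by the real places of `F₀`
    refine Finset.prod_bij (fun w hw => ⟨vK w, ((Finset.mem_filter.mp hw).2).2⟩) (fun w hw => Finset.mem_univ _)
      (fun w₁ hw₁ w₂ hw₂ h => ?_) (fun v _ => ⟨s v.1, Finset.mem_filter.mpr ⟨Finset.mem_univ _,
        by rw [hsv], by rw [hsv]; exact v.2⟩, Subtype.ext (hsv v.1)⟩) (fun w hw => ?_)
    · have h' : vK w₁ = vK w₂ := congrArg Subtype.val h
      rw [← ((Finset.mem_filter.mp hw₁).2).1, ← ((Finset.mem_filter.mp hw₂).2).1, h']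
    · obtain ⟨hw1, -⟩ := (Finset.mem_filter.mp hw).2
      change archUnitaryValue (b (vK w)) 0 (ιK w ((Z : InfiniteAdeleRing K) w)) =
        archUnitaryValue (b (vK w)) 0 (ιK (s (vK w)) ((Z : InfiniteAdeleRing K) (s (vK w))))
      rw [hw1]
  -- assemble
  have hRprod : ∏ v : {v : InfinitePlace F₀ // v.IsReal},
      (modPart v.1 v.2 Z : ℂ) * archUnitaryValue (b v.1) 0 (ιK (s v.1) ((Z : InfiniteAdeleRing K) (s v.1))) =
        ∏ v : {v : InfinitePlace F₀ // v.IsReal}, (loc v.1 (cpt v.1 x) : ℂ) :=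
    Finset.prod_congr rfl fun v _ => hreal v.1 v.2
  have hCprod : ∏ v : {v : InfinitePlace F₀ // ¬ v.IsReal},
      (cplxPart v.1 (InfinitePlace.not_isReal_iff_isComplex.mp v.2) Z : ℂ) =
        ∏ v : {v : InfinitePlace F₀ // ¬ v.IsReal}, (loc v.1 (cpt v.1 x) : ℂ) :=
    Finset.prod_congr rfl fun v _ => hcplx v.1 _
  rw [hΦ_apply, hdecomp, hPR_apply, hPC_apply, Units.coe_prod, Units.coe_prod, hSgnZ, mul_right_comm,
    ← Finset.prod_mul_distrib, hRprod, hCprod]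
  exact Fintype.prod_subtype_mul_prod_subtype (fun v : InfinitePlace F₀ => v.IsReal)
    (fun v => (loc v (cpt v x) : ℂ))

end QuadraticExtension

/-! ### §5. Discharge of the named fact -/

open QuadraticExtension in
/-- **Hewitt–Ross (24.12) for `C_{F₀} ↪ C_K`, `K/F₀` quadratic — the named fact
`HewittRoss_heckeCharacter_extension_quadratic` holds**: every unitary Hecke character `χ₀` of
`F₀` is the restriction along `𝕀_{F₀} → 𝕀_K` of a unitary Hecke character of `K` unramified at a
prescribed set `U` of finite places, provided `χ₀` is unramified below `u` whenever `u, c • u ∈ U`.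
Proof WITHOUT the duality theorem: `exists_archChar_baseChange_eq` (an archimedean character over
`χ₀,∞`) and `exists_extension_quadratic_of_archChar` (Weil's extension principle, the obstruction
on the norm-one units `k / c k` being killed by the Dirichlet freedom
`exists_archParams_prod_archUnitaryValue_unit_eq`).
[cite: HewittRoss1979, Thm. (24.12)] [cite: Weil1956, §1] -/
theorem HewittRoss_heckeCharacter_extension_quadratic_holds' (F₀ K : Type) [Field F₀] [NumberField F₀]
    [Field K] [NumberField K] [Algebra F₀ K] (c : K ≃ₐ[F₀] K) (h2 : Module.finrank F₀ K = 2) (hc : c ≠ 1)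
    (χ₀ : HeckeCharacter F₀) (hχ₀ : χ₀.IsUnitary) (U : Set (HeightOneSpectrum (𝓞 K)))
    (hU : ∀ u ∈ U, c • u ∈ U → χ₀.IsUnramifiedAt (u.under (𝓞 F₀))) :
    ∃ χ : HeckeCharacter K, χ.IsUnitary ∧
      (∀ x, χ (AdeleRing.ideleBaseChange F₀ K x) = χ₀ x) ∧ ∀ u ∈ U, χ.IsUnramifiedAt u := by
  obtain ⟨Φ, hΦ, hα⟩ := exists_archChar_baseChange_eq (F₀ := F₀) (K := K) χ₀ hχ₀
  exact exists_extension_quadratic_of_archChar F₀ K c h2 hc χ₀ hχ₀ Φ hΦ hα U hU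

end HeckeCharacter

/-- **Discharge of `HewittRoss_heckeCharacter_extension_quadratic`** (D-0014 named fact of
`HeckeCharacterExtensionQuadratic.lean`; proof: `HeckeCharacter.HewittRoss_heckeCharacter_extension_quadratic_holds'`).
[cite: HewittRoss1979, Thm. (24.12)] [cite: Weil1956, §1] -/
theorem HewittRoss_heckeCharacter_extension_quadratic_holds : HewittRoss_heckeCharacter_extension_quadratic :=
  fun F₀ K _ _ _ _ _ c h2 hc χ₀ hχ₀ U hU =>
    HeckeCharacter.HewittRoss_heckeCharacter_extension_quadratic_holds' F₀ K c h2 hc χ₀ hχ₀ U hU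

end Literature.NumberTheory.GaloisRepresentations

end
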